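import Summits.HodgeConjecture.HodgeConjecture.Theorems.F0P6aStubFROBRoofGeo
import Summits.HodgeConjecture.HodgeConjecture.Theorems.F0P6aLineSpecialisation
import Summits.HodgeConjecture.HodgeConjecture.Theorems.F0P6aRoofCwKernel
import Summits.HodgeConjecture.HodgeConjecture.Theorems.F0P6aRoofFrobKernelLawAssembly
import Summits.HodgeConjecture.HodgeConjecture.Theorems.F0P6aRoofWCounts
import Summits.HodgeConjecture.HodgeConjecture.Theorems.F0P6aRoofWInstantiation
import Literature.AlgebraicGeometry.AbelianSchemes.SerreTranslateCoverLeg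
import Literature.AlgebraicGeometry.AbelianSchemes.RoofLegsSpecialFibre
import Literature.RingTheory.DedekindDomain.CRTIdempotentFamily
import Summits.HodgeConjecture.HodgeConjecture.Theorems.F0P6aRoofKernelCount
import Summits.HodgeConjecture.HodgeConjecture.Theorems.F0P6aKillEngine
import Summits.HodgeConjecture.HodgeConjecture.Theorems.F0P6aKillEngineW
import Summits.HodgeConjecture.HodgeConjecture.Theorems.F0P6aStubFROBRoofMiddleDual
import Summits.HodgeConjecture.HodgeConjecture.Theorems.F0P6aStubFROBRoofLegs
import Literature.AlgebraicGeometry.AbelianSchemes.KerPointsCountOfKernelClause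
import Literature.NumberTheory.NumberFields.SerreTensorPresentationOfIdeal
import Literature.AlgebraicGeometry.AbelianSchemes.PolarizationUnitHypothesis
import Literature.AlgebraicGeometry.Resolution.ReducedOfSmoothOverReduced
import HarnessLib
import HarnessLib.Audit.LibrarySuggestionsDenyListCruxes

/-!
# `F0P6aStubFROBRoofGeoWiringWiring` — ★ RE-HOME of the crux workfile `Lines/F0_P6a_StubFROBRoofGeoWiring.lean` (tree sha16 46cdc102588d6598, 1102 l., 27 declaration commands, code-`sorry`-free), PART 1 of 4

This `Theorems/` module is the TREE BYTES of that workfile with the NAMESPACE KEPT, so every fully-qualified name is UNCHANGED; only this module docstring is re-headed,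
the `Lines` imports are switched to their ★ re-homed twins — `Lines.F0_P6a_StubFROBRoofGeo` → ★ `Theorems.F0P6aStubFROBRoofGeo`; `Lines.F0_P6a_LineSpecialisation` → ★ `Theorems.F0P6aLineSpecialisation`; `Lines.F0_P6a_RoofCwKernel` → ★ `Theorems.F0P6aRoofCwKernel`; `Lines.F0_P6a_RoofFrobKernelLawAssembly` → ★ `Theorems.F0P6aRoofFrobKernelLawAssembly`; `Lines.F0_P6a_RoofWCounts` → ★ `Theorems.F0P6aRoofWCounts`; `Lines.F0_P6a_RoofWInstantiation` → ★ `Theorems.F0P6aRoofWInstantiation`; `Lines.F0_P6a_RoofKernelCount` → ★ `Theorems.F0P6aRoofKernelCount`; `Lines.F0_P6a_KillEngine` → ★ `Theorems.F0P6aKillEngine`; `Lines.F0_P6a_KillEngineW` → ★ `Theorems.F0P6aKillEngineW`; `Lines.F0_P6a_StubFROBRoofMiddleDual` → ★ `Theorems.F0P6aStubFROBRoofMiddleDual`; `Lines.F0_P6a_StubFROBRoofLegs` → ★ `Theorems.F0P6aStubFROBRoofLegs` — and the audit carrier `LibrarySuggestionsDenyListCruxes` is CARRIED on this root part (bare import,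 LEAD «M-142d» (1) rule «P-κ»; parts 2…n inherit it transitively)
Why a re-home: a `Theorems/` file cannot import a `Lines/` workfile (F0P6-ref1 o-6), and closing stmt-HodgeConjecture-24832 `--as proved --by <Theorems decl>` at rung 0 needs the
sorry-free `Lines` chain behind the gate (RE-HOME TABLE v1.7, LA7-plan (g7); PLAN «L3 cone RE-HOME» v1, LA3-plan (g5); LEAD F0P6-plan (g5) «M-140» (1)∕(4), 2026-09-02).
SIZE LINT (`Theorems/` files with proofs ≤ 400 l.): the workfile is cut into 4 consecutive parts `F0P6aStubFROBRoofGeoWiringWiring` → `F0P6aStubFROBRoofGeoWiringAdapters` → `F0P6aStubFROBRoofGeoWiringHoleDischargers` → `F0P6aStubFROBRoofGeoWiring`; this is PART 1 (tree lines :1–:339); each later part imports the previous one and re-opens the scopes open at its cut with their `variable`∕`open`∕`set_option` lines replayed verbatim; the LAST part `F0P6aStubFROBRoofGeoWiring` is the module the `Lines/` shim and consumers import.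
After the chain is ★ the `Lines` workfile becomes a one-import SHIM of `F0P6aStubFROBRoofGeoWiring` (a `Lines/` write, batched per cone on the LEAD՚s word), so no environment holds two copies (NO-CROSS-IMPORT).
It asserts nothing beyond what the workfile already proves.  HC_CM is proved only modulo the 7 printed citations (2 remaining: hLiu418 = stmt-HodgeConjecture-24832, h413 = stmt-HodgeConjecture-24833) until rung 0 closes; a re-home is count-neutral.

## Original module docstring (verbatim)
# W5b — LEAFLET `Lines/F0_P6a_StubFROBRoofGeoWiring.lean` cand (LA3-p03 (g4); LA3-plan (g2) RULE 31∕32∕34): THE HOLE WIRING of the `stub_ROOFGEO` junction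

`crux_decl: Summit.HodgeConjecture.HodgeConjecture.Theses.HCCMUnconditional.HLiu418`.  Cell `hodgecm-mathlib`, line L3 (socket `stub_FROB` ▸ `stub_ROOFGEO`); item
stmt-HodgeConjecture-24832, count-neutral, nothing registered, no crux write (HOME-first).  HC_CM is proved only modulo the 7 printed citations (2 remaining: hLiu418 =
stmt-HodgeConjecture-24832, h413 = stmt-HodgeConjecture-24833) until rung 0 closes.

W5a `Lines/F0_P6a_StubFROBRoofGeo.lean` ED. 1 fb6a2bad (LA3-p02 (g3); SERVED) is imported BY NAME (§E holes as named `Prop`s, `roofgeo_of_inputs` with the holes as binders).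
THIS LEAFLET (namespace `…F0P6aStubFROBRoofGeoWiring`):
* §E′ ROW-HOLES in their suppliers' currencies: `HoleKill` ((KE) HEAD-K `quotIncl_spGeoOf_comp_eq_one_of_kerRow`), `HoleCLW` ((KEW) HEAD-W `exists_wWitness_of_kerRow` = W7 §6a's
  `hclw` ∃-pack), `HoleFin` ((FIN₀)), `HoleRkK` ((RK₀)+(r1)+(RKC) `natCard_roofKernel_eq`);
* §W WIRING: `holeRL_of_W3 : HoleRL I` (W3 `hL_sch₀Of`), `holeHF_of_W7 : HoleHF I 𝔡` (W7 §5), `holeDock_of_W7 : … → HoleDock …` (W7 §7 under the GUARD), `hrkN_of_W7`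
  (W7 §6a.2, GAP-2's `hrkN` binder), `holeHlawW_of_GAP2 : … → HoleHlawW …` (GAP-2 §4 `hlaw_w_sch₀Of_of_twistNorm` over `HoleMiddle`∕`HoleR3q`∕`HoleR4q`∕`HoleKer`∕`HoleDock`∕
  `HoleHF`∕W2 `hsat_sch₀Of`∕W7 `hrkw_sch₀Of`∕`hrkN_of_W7`);
* §I (LA1-p03 (g4)), §R (LA1-p03 (g4)), §A + §D (LA3-p02 (g3)), §K, and HEAD″ `roofgeo_closed_of_sigma` (RULE 36∕40: the socket's binders + `hσ` + `(frobIdeal) (hfrob)`, ZERO holes);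
* HEAD′ `roofgeo_of_organs` = W5a `roofgeo_of_inputs` with `hole_dock hole_hF hole_hlaw_w hole_rL` DISCHARGED — residual junction inputs = `qbarOf` + rows
  `HoleMono HoleR1 HoleR4q HoleR5q HoleR3q HoleKer HoleFin HoleRkK` (W1-a head′), `HoleMiddle` (W1-b), `HoleKill`∕`HoleCLW` ((KE)∕(KEW) ∘ (K3₀)), `hunr`, twist tokens.
BUDGET LESSON (LA1-p02 (g3) 09:51Z, confirmed here): never let the unifier COMPARE two scheme morphisms ∕ transport along the `SubOf`-equation `spGeoOf = kerFOf` with `▸`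
at these carriers — `generalize … ; subst` is syntactic and free.
[cite: Liu2021, Prop. D.8 (3) p. 135, pp. 136–138] [cite: Tate1997FiniteFlatGroupSchemes, (3.7)] [cite: Kottwitz1992, §5 (p. 391)]
-/

set_option autoImplicit false
set_option linter.dupNamespace false
set_option linter.unusedSectionVars false

noncomputable section

namespace Summit.HodgeConjecture.HodgeConjecture.Cruxes.HLiu418.F0P6aStubFROBRoofGeoWiring

open CategoryTheory CategoryTheory.Limits NumberField IsDedekindDomain MulAction AlgebraicGeometry
open scoped Matrix Pointwise MonoidalCategory MonObj CategoryTheory.Obj Polynomial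
open Literature.NumberTheory.GaloisRepresentations
open Literature.NumberTheory.Automorphic Literature.NumberTheory.Automorphic.UnitaryGroup
open Literature.AlgebraicGeometry.ShimuraVarieties.UnitaryCanonicalModel
open Literature.NumberTheory.Automorphic.Liu2021.AppendixC
open Literature.AlgebraicGeometry.Motives (AlgPoints IntegralModel SchemeOver thickening thickeningLift specOver relFrobeniusOver frobeniusTwistOver frobSpec)
open Literature.NumberTheory.DiophantineGeometry (geomResidueField specialFibreFunctor specResidueField)
open Literature.AlgebraicGeometry.RelativeSpec (ActionOver)
open Literature.AlgebraicGeometry.GroupSchemes Literature.AlgebraicGeometry.GroupSchemes.GroupSchemeKernel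
open Literature.AlgebraicGeometry.GroupSchemes.AffineGroupScheme (Alg quotIncl)
open Literature.AlgebraicGeometry.AbelianSchemes Literature.AlgebraicGeometry.AbelianSchemes.AbelianSchemeOver
open Summit.HodgeConjecture.HodgeConjecture.Cruxes.HLiu418.F0P6aModuliDatumDefs
open Summit.HodgeConjecture.HodgeConjecture.Cruxes.HLiu418.F0P6aRGDAssembly
open Summit.HodgeConjecture.HodgeConjecture.Cruxes.HLiu418.F0P6aDatumOfInputs
open Summit.HodgeConjecture.HodgeConjecture.Cruxes.HLiu418.F0P6aLineSpecialisation (spGeoOf)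
open Summit.HodgeConjecture.HodgeConjecture.Cruxes.HLiu418.F0P6aRoofCwKernel (hsat_sch₀Of)
open Summit.HodgeConjecture.HodgeConjecture.Cruxes.HLiu418.F0P6aStubFROBRoofGeo

variable {F : Type} [Field F] [NumberField F] [IsCMField F] [IsGalois ℚ F] {ι₁ : F →+* ℂ}
    {Jstar : Matrix (Fin 2) (Fin 2) F}
    {K₀ : C5.OpenCompactSubgroup ↥(finAdelic ↥(maximalRealSubfield F) F (IsCMField.complexConj F) 2 Jstar)}
    {S : RecordSystemGS F Jstar ι₁ K₀} {hU7ₛ : S.HeckeTranslateDefinedOver}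
    {hJ : (Jstar.map (IsCMField.complexConj F))ᵀ = Jstar} {hJu : IsUnit Jstar}
    {Fi : Type} [Field Fi] [Algebra F Fi] {Kc : C5.SmallLevel K₀} {G : Type} [Group G]
    {𝓜 : IntegralModel (𝓞 F) F ((thickening F Fi).obj (S.M.obj Kc))}
    {w : HeightOneSpectrum (𝓞 F)} {hw : (IsCMField.complexConj F) • w ≠ w} {h𝓨 : (𝓜.localise w).IsSmoothProper 1}
    {θ : ActionOver (𝓜.localise w).total.hom ((Fi ≃ₐ[F] Fi) × G)}
    {e : Fi →ₐ[F] AlgebraicClosure (w.adicCompletion F)}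

/-! ## §E′ — THE ROW-HOLES the §7 ∕ GAP-2 suppliers consume, as named `Prop`s in their suppliers' currencies -/

section RowHoles

variable (I : RGDInputsAt F ι₁ Jstar K₀ S hU7ₛ hJ hJu Fi Kc G 𝓜 w hw h𝓨 θ e) [ExpChar (geomResidueField w) I.pChar]
  (𝔡 : ∀ xbar, DockAt I xbar)
  (quotΩ : ∀ y, LineOf I y → AlgPoints (S.M.obj Kc) (AlgebraicClosure (w.adicCompletion F)))
  {m : ℕ} (E' : Matrix (Fin m) (Fin m) (𝓞 F)) (hE' : E' * E' = E')
  (qbarOf : QbarTy I quotΩ E' hE')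

/-- HOLE (K) ⇐ (KE) HEAD-K `quotIncl_spGeoOf_comp_eq_one_of_kerRow` (LA1-p02 (g3), `c•w` side; `Lines/F0_P6a_KillEngine.lean` ED. 1): (KILL) — `q̄` kills
`V(spGeoOf I 𝔡 y L) ↪ G₀(x̄) ↪ A_x̄` (tautological currency of (ρ1𝒞) §B). (print: Liu2021, Prop. D.8 (3) p. 137) -/
def HoleKill : Prop :=
  haveI := I.comm
  ∀ (y : AlgPoints (S.M.obj Kc) (AlgebraicClosure (w.adicCompletion F))) (L : LineOf I y),
    haveI := (𝔡 (red₀Of S Kc 𝓜 w h𝓨 e y)).aff₀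
    quotIncl (𝔡 (red₀Of S Kc 𝓜 w h𝓨 e y)).G₀ (spGeoOf I 𝔡 y L).1 ≫ (𝔡 (red₀Of S Kc 𝓜 w h𝓨 e y)).ι₀G ≫ qbarOf y L = 1

/-- HOLE (W) ⇐ (KEW) HEAD-W `exists_wWitness_of_kerRow` (LA1-p02 (g3), (CL-w); `Lines/F0_P6a_KillEngineW.lean` ED. 1): the `w`-side witness — a closed `ν : V ↪ A_x̄` of
`𝔭_w`-torsion `q̄`-killed points of rank `≥ q` (W7 §6a's `hclw` ∃-pack VERBATIM at `x̄ := red₀Of … y`). (print: Liu2021, Appendix D, Prop. D.8 (3) (p. 137)) -/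
def HoleCLW : Prop :=
  haveI := I.comm
  ∀ (y : AlgPoints (S.M.obj Kc) (AlgebraicClosure (w.adicCompletion F))) (L : LineOf I y),
    ∃ (V : SchemeOver (geomResidueField w)) (ν : V ⟶ (sch₀Of 𝓜 w I.univ (red₀Of S Kc 𝓜 w h𝓨 e y)).X), IsClosedImmersion ν.left ∧
      (∀ ⦃T : SchemeOver (geomResidueField w)⦄ (t : T ⟶ (sch₀Of 𝓜 w I.univ (red₀Of S Kc 𝓜 w h𝓨 e y)).X), (∃ s : T ⟶ V, s ≫ ν = t) →
        (∀ r ∈ w.asIdeal, t ≫ (act₀Of 𝓜 w I.univ I.act r (red₀Of S Kc 𝓜 w h𝓨 e y)).hom.hom.hom = 1) ∧ t ≫ qbarOf y L = 1) ∧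
      I.pChar ^ I.fDeg ≤ Module.finrank (geomResidueField w) (Alg V)

/-- HOLE (FIN) ⇐ W1-a head′ row (FIN₀): `q̄.left` is finite. (print: MumfordAV1970, §15 Thm. 1 (p. 143)) -/
def HoleFin : Prop :=
  haveI := I.comm
  ∀ (y : AlgPoints (S.M.obj Kc) (AlgebraicClosure (w.adicCompletion F))) (L : LineOf I y), IsFinite (qbarOf y L).left

/-- HOLE (RK) ⇐ W1-a head′ rows (RK₀)+(r1) + (RKC) `natCard_roofKernel_eq` ((ρ2‴), LA2-p03 (g2); bridge ★ p850619, LA1-p02 (g3) 09:51Z `hrkK_of_kerRow`):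
`dim_κ̄ Γ(Ker q̄) = q · q`. (print: Liu2021, Prop. D.8 (pp. 135–138)) -/
def HoleRkK : Prop :=
  haveI := I.comm
  ∀ (y : AlgPoints (S.M.obj Kc) (AlgebraicClosure (w.adicCompletion F))) (L : LineOf I y),
    Module.finrank (geomResidueField w) (Alg (GroupSchemeKernel.ker (qbarOf y L))) = I.pChar ^ I.fDeg * I.pChar ^ I.fDeg

end RowHoles

/-! ## §W — THE WIRING: holes discharged BY NAME from BUILT suppliers -/

section Wiring

variable (I : RGDInputsAt F ι₁ Jstar K₀ S hU7ₛ hJ hJu Fi Kc G 𝓜 w hw h𝓨 θ e) [ExpChar (geomResidueField w) I.pChar]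
  (𝔡 : ∀ xbar, DockAt I xbar)
  (quotΩ : ∀ y, LineOf I y → AlgPoints (S.M.obj Kc) (AlgebraicClosure (w.adicCompletion F)))
  {m : ℕ} (E' : Matrix (Fin m) (Fin m) (𝓞 F)) (hE' : E' * E' = E') (P : Matrix (Fin m) (Fin 1) (𝓞 F))
  (qbarOf : QbarTy I quotΩ E' hE')

/-- **(I) `HoleRL` ← W3 `hL_sch₀Of`** (BUILT `Lines/F0_P6a_RoofFrobKernelLawAssembly.lean` cf7bc338 :202; binder lists token for token). [cite: Liu2021, Prop. D.8 (3) p. 135] -/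
theorem holeRL_of_W3 : HoleRL I := by
  intro _ _ _
  exact F0P6aRoofFrobKernelLawAssembly.hL_sch₀Of I

/-- **(F) `HoleHF` ← W7 §5 `hF_sch₀Of`** (★ p850282 glue, one `exact`). [cite: SGA3I, VII_A 4.1] -/
theorem holeHF_of_W7 : HoleHF I 𝔡 :=
  fun xbar _ t => F0P6aRoofWCounts.hF_sch₀Of I 𝔡 xbar t


set_option maxHeartbeats 400000 in
/-- **(D-text) W7 §7 at `(y, L)` for ANY admissible `H` (KILL)ed by `q̄_{y,L}`, conclusion in the junction's TEXT** — the bridge that re-elaborates §7's output at the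
junction's carriers ONCE, in its own budget (LA1-p02 (g3) 09:51Z lesson; measured here: §7-output ↔ junction text ≈ one 400 000 budget, so nothing else may ride along).
[cite: Tate1997FiniteFlatGroupSchemes, (3.7)] [cite: Liu2021, Appendix D, Prop. D.8 (3) (p. 137)] -/
theorem dock_text_of_W7 (hole_mono : HoleMono I quotΩ E' hE' qbarOf) (hole_r4q : HoleR4q I quotΩ E' hE' qbarOf) (hole_ker : HoleKer I quotΩ E' hE' qbarOf)
    (hole_fin : HoleFin I quotΩ E' hE' qbarOf) (hole_rkK : HoleRkK I quotΩ E' hE' qbarOf) (hole_clw : HoleCLW I quotΩ E' hE' qbarOf)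
    (y : AlgPoints (S.M.obj Kc) (AlgebraicClosure (w.adicCompletion F))) (L : LineOf I y)
    (H : SubOf I 𝔡 (red₀Of S Kc 𝓜 w h𝓨 e y))
    (hkill : haveI := I.comm; haveI := (𝔡 (red₀Of S Kc 𝓜 w h𝓨 e y)).aff₀
      quotIncl (𝔡 (red₀Of S Kc 𝓜 w h𝓨 e y)).G₀ H.1 ≫ (𝔡 (red₀Of S Kc 𝓜 w h𝓨 e y)).ι₀G ≫ qbarOf y L = 1)
    ⦃T : SchemeOver (geomResidueField w)⦄ (t : T ⟶ (𝔡 (red₀Of S Kc 𝓜 w h𝓨 e y)).G₀) :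
    haveI := I.comm
    haveI := (𝔡 (red₀Of S Kc 𝓜 w h𝓨 e y)).aff₀
    t ≫ (𝔡 (red₀Of S Kc 𝓜 w h𝓨 e y)).ι₀G ≫ qbarOf y L = 1 ↔
      ∃ s : T ⟶ specOver (geomResidueField w) (Alg (𝔡 (red₀Of S Kc 𝓜 w h𝓨 e y)).G₀ ⧸ H.1),
        s ≫ quotIncl (𝔡 (red₀Of S Kc 𝓜 w h𝓨 e y)).G₀ H.1 = t := by
  haveI := I.comm
  haveI := hole_mono y L
  have hr4 : ∀ a : 𝓞 F, ∃ b : (sch₀Of 𝓜 w (serreTensor I.act E' hE') (red₀Of S Kc 𝓜 w h𝓨 e (quotΩ y L))).X ⟶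
      (sch₀Of 𝓜 w (serreTensor I.act E' hE') (red₀Of S Kc 𝓜 w h𝓨 e (quotΩ y L))).X,
      (act₀Of 𝓜 w I.univ I.act a (red₀Of S Kc 𝓜 w h𝓨 e y)).hom.hom.hom ≫ qbarOf y L = qbarOf y L ≫ b :=
    fun a => ⟨_, hole_r4q y L a⟩
  have h7 := F0P6aRoofWCounts.comp_ι₀G_comp_eq_one_iff_of_kill_sch₀Of I 𝔡 (red₀Of S Kc 𝓜 w h𝓨 e y) (qbarOf y L)
    hr4 (hole_ker y L) (hole_fin y L) (hole_rkK y L) H hkill (hole_clw y L) t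
  exact h7

set_option maxHeartbeats 400000 in
/-- **(D) `HoleDock` ← W7 §7** modulo the per-`(y, L)` rows (B0) `HoleMono`, (B4) `HoleR4q`, (C) `HoleKer`, (FIN) `HoleFin`, (RK) `HoleRkK`, (K) `HoleKill`, (W) `HoleCLW`:
(KILL) is carried from `spGeoOf I 𝔡 y L` to `kerFOf I 𝔡 x̄` along the GUARD by `Eq.subst` with an EXPLICIT motive (no `kabstract`∕`generalize`∕`▸` at the carriers — each of those
alone exhausts 400 000), then `dock_text_of_W7` at `H := kerFOf I 𝔡 x̄`. [cite: Tate1997FiniteFlatGroupSchemes, (3.7)] [cite: Liu2021, Appendix D, Prop. D.8 (3) (p. 137)] -/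
theorem holeDock_of_W7 (hole_mono : HoleMono I quotΩ E' hE' qbarOf) (hole_r4q : HoleR4q I quotΩ E' hE' qbarOf) (hole_ker : HoleKer I quotΩ E' hE' qbarOf)
    (hole_fin : HoleFin I quotΩ E' hE' qbarOf) (hole_rkK : HoleRkK I quotΩ E' hE' qbarOf)
    (hole_kill : HoleKill I 𝔡 quotΩ E' hE' qbarOf) (hole_clw : HoleCLW I quotΩ E' hE' qbarOf) :
    HoleDock I 𝔡 quotΩ E' hE' qbarOf := by
  haveI := I.comm
  intro y L hsp T t
  -- (KILL) moved from `spGeoOf I 𝔡 y L` to `kerFOf I 𝔡 x̄` along the GUARD with an EXPLICIT motive (no `kabstract` at the carriers)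
  have hk : (haveI := (𝔡 (red₀Of S Kc 𝓜 w h𝓨 e y)).aff₀
      quotIncl (𝔡 (red₀Of S Kc 𝓜 w h𝓨 e y)).G₀ (kerFOf I 𝔡 (red₀Of S Kc 𝓜 w h𝓨 e y)).1 ≫ (𝔡 (red₀Of S Kc 𝓜 w h𝓨 e y)).ι₀G ≫ qbarOf y L = 1) :=
    @Eq.subst (SubOf I 𝔡 (red₀Of S Kc 𝓜 w h𝓨 e y))
      (fun X => haveI := (𝔡 (red₀Of S Kc 𝓜 w h𝓨 e y)).aff₀
        quotIncl (𝔡 (red₀Of S Kc 𝓜 w h𝓨 e y)).G₀ X.1 ≫ (𝔡 (red₀Of S Kc 𝓜 w h𝓨 e y)).ι₀G ≫ qbarOf y L = 1)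
      _ _ hsp (hole_kill y L)
  exact dock_text_of_W7 I 𝔡 quotΩ E' hE' qbarOf hole_mono hole_r4q hole_ker hole_fin hole_rkK hole_clw y L
    (kerFOf I 𝔡 (red₀Of S Kc 𝓜 w h𝓨 e y)) hk t

set_option maxHeartbeats 400000 in
/-- **(k2b′) the `w`-side count `hrkN`** in GAP-2 `hlaw_w_sch₀Of`'s binder shape ← W7 §6a.2 (no `hrkcw`, no `hdock`), modulo the same rows; `H := spGeoOf I 𝔡 y L` (NO guard —
any admissible member carries `dim Γ(G₀) ⧸ H = q`). [cite: Tate1997FiniteFlatGroupSchemes, (3.7)] [cite: Liu2021, Appendix D, Prop. D.8 (3) (p. 137)] -/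
theorem hrkN_of_W7 (hole_mono : HoleMono I quotΩ E' hE' qbarOf) (hole_r4q : HoleR4q I quotΩ E' hE' qbarOf) (hole_ker : HoleKer I quotΩ E' hE' qbarOf)
    (hole_fin : HoleFin I quotΩ E' hE' qbarOf) (hole_rkK : HoleRkK I quotΩ E' hE' qbarOf)
    (hole_kill : HoleKill I 𝔡 quotΩ E' hE' qbarOf) (hole_clw : HoleCLW I quotΩ E' hE' qbarOf)
    (y : AlgPoints (S.M.obj Kc) (AlgebraicClosure (w.adicCompletion F))) (L : LineOf I y) :
    haveI := I.comm
    ∀ {Z : SchemeOver (geomResidueField w)} (ζ : Z ⟶ (sch₀Of 𝓜 w I.univ (red₀Of S Kc 𝓜 w h𝓨 e y)).X) [Mono ζ],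
      (∀ ⦃T : SchemeOver (geomResidueField w)⦄ (x : T ⟶ (sch₀Of 𝓜 w I.univ (red₀Of S Kc 𝓜 w h𝓨 e y)).X),
        (∃ z : T ⟶ Z, z ≫ ζ = x) ↔ (∀ r ∈ w.asIdeal, x ≫ (act₀Of 𝓜 w I.univ I.act r (red₀Of S Kc 𝓜 w h𝓨 e y)).hom.hom.hom = 1) ∧ x ≫ qbarOf y L = 1) →
      Module.finrank (geomResidueField w) (Alg Z) = I.pChar ^ I.fDeg := by
  haveI := I.comm
  haveI := hole_mono y L
  have hr4 : ∀ a : 𝓞 F, ∃ b : (sch₀Of 𝓜 w (serreTensor I.act E' hE') (red₀Of S Kc 𝓜 w h𝓨 e (quotΩ y L))).X ⟶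
      (sch₀Of 𝓜 w (serreTensor I.act E' hE') (red₀Of S Kc 𝓜 w h𝓨 e (quotΩ y L))).X,
      (act₀Of 𝓜 w I.univ I.act a (red₀Of S Kc 𝓜 w h𝓨 e y)).hom.hom.hom ≫ qbarOf y L = qbarOf y L ≫ b :=
    fun a => ⟨_, hole_r4q y L a⟩
  have h6 := F0P6aRoofWCounts.finrank_readings_of_kill_sch₀Of I 𝔡 (red₀Of S Kc 𝓜 w h𝓨 e y) (qbarOf y L)
    hr4 (hole_ker y L) (hole_fin y L) (hole_rkK y L) (spGeoOf I 𝔡 y L) (hole_kill y L) (hole_clw y L)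
  intro Z ζ _ hZ
  exact h6.2 ζ hZ

set_option maxHeartbeats 400000 in
/-- **(H) `HoleHlawW` ← GAP-2 §4 `hlaw_w_sch₀Of_of_twistNorm`** (BUILT `Lines/F0_P6a_RoofWInstantiation.lean` f62ef70b :521) at `x̄ := red₀Of … y`, `q̄ := qbarOf y L`,
`𝔠 := frobIdeal γ`: the downstairs dual of `𝒞_{x̄″}` and its `c̄`-row from `HoleMiddle`, (r3₀-q) from `HoleR3q`, `hr4` from `HoleR4q`, the twist tokens `h𝔠 hspec hnorm hpin` from the
junction's binders, `hkerq` from `HoleKer`, `hdock` from `HoleDock` UNDER THE GUARD (FINDING 1), `hF` from `HoleHF`, `hsat` from W2 `hsat_sch₀Of` + `hunr`, `hrkw` from W7 §1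
`hrkw_sch₀Of`, `hrkN` from `hrkN_of_W7`. [cite: Liu2021, Prop. D.8 (3) pp. 136–138] [cite: Tate1997FiniteFlatGroupSchemes, (3.7)] -/
theorem holeHlawW_of_GAP2 (𝔞 : (Fi ≃ₐ[F] Fi) → Ideal (𝓞 F)) (𝔫 : (Fi ≃ₐ[F] Fi) → ℕ)
    (_hnorm : ∀ (σ : Field.absoluteGaloisGroup (w.adicCompletion F)), IsAbsArithFrob σ → ∀ gam : Fi ≃ₐ[F] Fi,
        ((AlgEquiv.restrictScalars F (Field.absoluteGaloisGroup.toAlgEquiv (w.adicCompletion F) σ) :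
            AlgebraicClosure (w.adicCompletion F) ≃ₐ[F] AlgebraicClosure (w.adicCompletion F)) :
            AlgebraicClosure (w.adicCompletion F) →ₐ[F] AlgebraicClosure (w.adicCompletion F)).comp e = e.comp (gam : Fi →ₐ[F] Fi) →
        𝔫 gam = I.pChar ^ I.fDeg)
    (_hpin : ∀ (σ : Field.absoluteGaloisGroup (w.adicCompletion F)), IsAbsArithFrob σ → ∀ gam : Fi ≃ₐ[F] Fi,
        ((AlgEquiv.restrictScalars F (Field.absoluteGaloisGroup.toAlgEquiv (w.adicCompletion F) σ) :
            AlgebraicClosure (w.adicCompletion F) ≃ₐ[F] AlgebraicClosure (w.adicCompletion F)) :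
            AlgebraicClosure (w.adicCompletion F) →ₐ[F] AlgebraicClosure (w.adicCompletion F)).comp e = e.comp (gam : Fi →ₐ[F] Fi) →
        𝔞 gam ⊔ (((IsCMField.complexConj F) • w).asIdeal : Ideal (𝓞 F)) = ⊤ ∧
          FrobKernelBanal₀ S Kc 𝓜 w h𝓨 e I.univ I.act I.pChar I.fDeg (𝔞 gam))
    (_hspec : ∀ gam : Fi ≃ₐ[F] Fi, Ideal.span {((𝔫 gam : ℕ) : 𝓞 F)} = 𝔞 gam * (IsCMField.complexConj F) • 𝔞 gam)
    (frobIdeal : (Fi ≃ₐ[F] Fi) → Ideal (𝓞 F))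
    (hole_mono : HoleMono I quotΩ E' hE' qbarOf) (hole_r4q : HoleR4q I quotΩ E' hE' qbarOf) (hole_r3q : HoleR3q I quotΩ E' hE' P qbarOf hole_mono)
    (hole_middle : HoleMiddle I E' hE' P) (hole_ker : HoleKer I quotΩ E' hE' qbarOf) (hole_dock : HoleDock I 𝔡 quotΩ E' hE' qbarOf)
    (hole_hF : HoleHF I 𝔡) (hunr : ¬ (w.asIdeal ^ 2 ∣ Ideal.span {((I.pChar : ℕ) : 𝓞 F)}))
    (hole_fin : HoleFin I quotΩ E' hE' qbarOf) (hole_rkK : HoleRkK I quotΩ E' hE' qbarOf)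
    (hole_kill : HoleKill I 𝔡 quotΩ E' hE' qbarOf) (hole_clw : HoleCLW I quotΩ E' hE' qbarOf) :
    HoleHlawW I 𝔡 quotΩ E' hE' qbarOf 𝔞 frobIdeal := by
  haveI := I.comm
  intro σ hσ gam hγ h𝔠 y L hsp
  haveI : Fact I.pChar.Prime := ⟨I.hpChar.1⟩
  haveI : CharP (geomResidueField w) I.pChar := I.charP₀
  haveI := hole_mono y L
  obtain ⟨DB, hDB, lamB, hlamB, h3c⟩ := hole_middle (red₀Of S Kc 𝓜 w h𝓨 e (quotΩ y L))
  haveI := hlamB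
  have hr4 : ∀ a : 𝓞 F, ∃ b : (sch₀Of 𝓜 w (serreTensor I.act E' hE') (red₀Of S Kc 𝓜 w h𝓨 e (quotΩ y L))).X ⟶
      (sch₀Of 𝓜 w (serreTensor I.act E' hE') (red₀Of S Kc 𝓜 w h𝓨 e (quotΩ y L))).X,
      (act₀Of 𝓜 w I.univ I.act a (red₀Of S Kc 𝓜 w h𝓨 e y)).hom.hom.hom ≫ qbarOf y L = qbarOf y L ≫ b :=
    fun a => ⟨_, hole_r4q y L a⟩
  have h := F0P6aRoofWInstantiation.hlaw_w_sch₀Of_of_twistNorm I 𝔡 (red₀Of S Kc 𝓜 w h𝓨 e y) (qbarOf y L) DB hDB lamB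
    (hole_r3q y L DB hDB lamB h3c) hr4 (frobIdeal gam) (𝔞 gam) (𝔫 gam) h𝔠 (_hspec gam) (_hnorm σ hσ gam hγ) (_hpin σ hσ gam hγ).1
    (hole_ker y L) (hole_dock y L hsp) (hole_hF (red₀Of S Kc 𝓜 w h𝓨 e y))
    (hsat_sch₀Of I (red₀Of S Kc 𝓜 w h𝓨 e y) (𝔡 (red₀Of S Kc 𝓜 w h𝓨 e y)) hunr)
    (F0P6aRoofWCounts.hrkw_sch₀Of I (red₀Of S Kc 𝓜 w h𝓨 e y))
    (fun ζ hm hζ => by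
      haveI := hm
      exact hrkN_of_W7 I 𝔡 quotΩ E' hE' qbarOf hole_mono hole_r4q hole_ker hole_fin hole_rkK hole_kill hole_clw y L ζ hζ)
  exact h

end Wiring

/-! ## HEAD′ — `roofgeo_of_organs`: W5a's `roofgeo_of_inputs` with `hole_dock`, `hole_hF`, `hole_hlaw_w`, `hole_rL` DISCHARGED by §W -/

section Head

set_option maxHeartbeats 400000 in
/-- **W5b HEAD′ `roofgeo_of_organs`** — `Quot₀RoofLaw I 𝔡 quotΩ (spGeoOf I 𝔡) frobIdeal` from W5a's junction `roofgeo_of_inputs` with the four supplier holes discharged by name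
(`holeDock_of_W7`, `holeHF_of_W7`, `holeHlawW_of_GAP2`, `holeRL_of_W3`); binders = `roofgeo_of_inputs`' TOKEN FOR TOKEN minus {`hole_dock`, `hole_hF`, `hole_hlaw_w`, `hole_rL`}
plus the four ROW-HOLES `hole_fin hole_rkK hole_kill hole_clw` (§E′).  Residual junction inputs: `qbarOf` + rows `HoleMono HoleR1 HoleR4q HoleR5q HoleR3q HoleKer HoleFin
HoleRkK` (W1-a head′), `HoleMiddle` (W1-b), `HoleKill` ((KE) HEAD-K), `HoleCLW` ((KEW) HEAD-W), `hunr` (spine), twist tokens (leaf).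
[cite: Liu2021, Prop. D.8 (3) p. 135, pp. 136–138] [cite: RapoportSmithlingZhang2020Diagonal, §4.3 (4.23) p. 21] [cite: Kottwitz1992, §5 (p. 391)] -/
theorem roofgeo_of_organs (I : RGDInputsAt F ι₁ Jstar K₀ S hU7ₛ hJ hJu Fi Kc G 𝓜 w hw h𝓨 θ e) [ExpChar (geomResidueField w) I.pChar]
    (𝔡 : ∀ xbar, DockAt I xbar)
    (quotΩ : ∀ y, LineOf I y → AlgPoints (S.M.obj Kc) (AlgebraicClosure (w.adicCompletion F)))
    (translΩ : AlgPoints (S.M.obj Kc) (AlgebraicClosure (w.adicCompletion F)) → AlgPoints (S.M.obj Kc) (AlgebraicClosure (w.adicCompletion F)))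
    (_hhecke : HeckeClause I quotΩ translΩ) (_hroof : RoofLink I quotΩ) (_hroof₂ : RoofLink₂ I translΩ)
    (_hunit : (UnitaryGroup.isUnit_placeForm Jstar hJu w).unit ∈ glInt 2 (w.adicCompletion F))
    (_hKc : UnitaryGroup.IsHyperspecialAt ↥(maximalRealSubfield F) F (IsCMField.complexConj F) 2 Jstar Kc.1.1
      (w.under (𝓞 ↥(maximalRealSubfield F))))
    (_hdisj : haveI : AlgebraicGeometry.IsProper (𝓜.localise w).total.hom := h𝓨.2
      ∀ (β : Fi ≃ₐ[F] Fi) (P Q : AlgPoints (S.M.obj Kc) (AlgebraicClosure (w.adicCompletion F))),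
        (𝓜.localise w).geomReductionMap (thickeningLift e (S.M.obj Kc) P) =
          AlgPoints.map ((specialFibreFunctor w).map (Over.isoMk (θ.aut (β, 1)) (θ.aut_comp (β, 1))).hom :
              (𝓜.localise w).reductionAt ⟶ (𝓜.localise w).reductionAt)
            ((𝓜.localise w).geomReductionMap (thickeningLift e (S.M.obj Kc) Q)) → β = 1)
    (𝔞 : (Fi ≃ₐ[F] Fi) → Ideal (𝓞 F)) (𝔫 : (Fi ≃ₐ[F] Fi) → ℕ)
    (_hdiv : ∀ (σ : Field.absoluteGaloisGroup (w.adicCompletion F)), IsAbsArithFrob σ → ∀ gam : Fi ≃ₐ[F] Fi,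
        ((AlgEquiv.restrictScalars F (Field.absoluteGaloisGroup.toAlgEquiv (w.adicCompletion F) σ) :
            AlgebraicClosure (w.adicCompletion F) ≃ₐ[F] AlgebraicClosure (w.adicCompletion F)) :
            AlgebraicClosure (w.adicCompletion F) →ₐ[F] AlgebraicClosure (w.adicCompletion F)).comp e = e.comp (gam : Fi →ₐ[F] Fi) →
        w.asIdeal ∣ 𝔞 gam)
    (_hnorm : ∀ (σ : Field.absoluteGaloisGroup (w.adicCompletion F)), IsAbsArithFrob σ → ∀ gam : Fi ≃ₐ[F] Fi,
        ((AlgEquiv.restrictScalars F (Field.absoluteGaloisGroup.toAlgEquiv (w.adicCompletion F) σ) :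
            AlgebraicClosure (w.adicCompletion F) ≃ₐ[F] AlgebraicClosure (w.adicCompletion F)) :
            AlgebraicClosure (w.adicCompletion F) →ₐ[F] AlgebraicClosure (w.adicCompletion F)).comp e = e.comp (gam : Fi →ₐ[F] Fi) →
        𝔫 gam = I.pChar ^ I.fDeg)
    (_hcov : ∀ (σ : Field.absoluteGaloisGroup (w.adicCompletion F)), IsAbsArithFrob σ → ∀ gam : Fi ≃ₐ[F] Fi,
        ((AlgEquiv.restrictScalars F (Field.absoluteGaloisGroup.toAlgEquiv (w.adicCompletion F) σ) :
            AlgebraicClosure (w.adicCompletion F) ≃ₐ[F] AlgebraicClosure (w.adicCompletion F)) :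
            AlgebraicClosure (w.adicCompletion F) →ₐ[F] AlgebraicClosure (w.adicCompletion F)).comp e = e.comp (gam : Fi →ₐ[F] Fi) →
        ∀ y : AlgPoints (S.M.obj Kc) (AlgebraicClosure (w.adicCompletion F)),
          FrobCover₀ 𝓜 w I.univ I.act I.dual I.pol I.lvl I.pChar I.fDeg (𝔞 gam) (𝔫 gam)
            (red₀Of S Kc 𝓜 w h𝓨 e (σ • y)) (red₀Of S Kc 𝓜 w h𝓨 e y))
    (_hpin : ∀ (σ : Field.absoluteGaloisGroup (w.adicCompletion F)), IsAbsArithFrob σ → ∀ gam : Fi ≃ₐ[F] Fi,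
        ((AlgEquiv.restrictScalars F (Field.absoluteGaloisGroup.toAlgEquiv (w.adicCompletion F) σ) :
            AlgebraicClosure (w.adicCompletion F) ≃ₐ[F] AlgebraicClosure (w.adicCompletion F)) :
            AlgebraicClosure (w.adicCompletion F) →ₐ[F] AlgebraicClosure (w.adicCompletion F)).comp e = e.comp (gam : Fi →ₐ[F] Fi) →
        𝔞 gam ⊔ (((IsCMField.complexConj F) • w).asIdeal : Ideal (𝓞 F)) = ⊤ ∧
          FrobKernelBanal₀ S Kc 𝓜 w h𝓨 e I.univ I.act I.pChar I.fDeg (𝔞 gam))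
    (_hspec : ∀ gam : Fi ≃ₐ[F] Fi, Ideal.span {((𝔫 gam : ℕ) : 𝓞 F)} = 𝔞 gam * (IsCMField.complexConj F) • 𝔞 gam)
    ---- the co-ideal `𝔠(γ) = 𝔞_γ 𝔭_w⁻¹`, abstract (leaf: `frobIdealOf 𝔞 w`, `frobIdealOf_mul_eq`) ----
    (frobIdeal : (Fi ≃ₐ[F] Fi) → Ideal (𝓞 F))
    (hfrob : ∀ (σ : Field.absoluteGaloisGroup (w.adicCompletion F)), IsAbsArithFrob σ → ∀ gam : Fi ≃ₐ[F] Fi,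
        ((AlgEquiv.restrictScalars F (Field.absoluteGaloisGroup.toAlgEquiv (w.adicCompletion F) σ) :
            AlgebraicClosure (w.adicCompletion F) ≃ₐ[F] AlgebraicClosure (w.adicCompletion F)) :
            AlgebraicClosure (w.adicCompletion F) →ₐ[F] AlgebraicClosure (w.adicCompletion F)).comp e = e.comp (gam : Fi →ₐ[F] Fi) →
        frobIdeal gam * w.asIdeal = 𝔞 gam)
    ---- W5 JUNCTION INPUTS (holes §E, one per supplier) ----
    {m : ℕ} (E' : Matrix (Fin m) (Fin m) (𝓞 F)) (hE' : E' * E' = E') (P : Matrix (Fin m) (Fin 1) (𝓞 F)) (Q : Matrix (Fin 1) (Fin m) (𝓞 F))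
    (hP : E' * P = P) (hQ : Q * E' = Q) (hQP : Q * P = Matrix.scalar (Fin 1) (I.pChar : 𝓞 F))
    (hPQ : P * Q = Matrix.scalar (Fin m) (I.pChar : 𝓞 F) * E') (h𝔭 : Ideal.span (Set.range fun k => P k 0) = w.asIdeal)
    (qbarOf : QbarTy I quotΩ E' hE')
    (hole_mono : HoleMono I quotΩ E' hE' qbarOf) (hole_r1 : HoleR1 I quotΩ E' hE' qbarOf)
    (hole_r4q : HoleR4q I quotΩ E' hE' qbarOf) (hole_r5q : HoleR5q I quotΩ E' hE' P qbarOf) (hole_r3q : HoleR3q I quotΩ E' hE' P qbarOf hole_mono)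
    (hole_middle : HoleMiddle I E' hE' P) (hole_ker : HoleKer I quotΩ E' hE' qbarOf)
    (hunr : ¬ (w.asIdeal ^ 2 ∣ Ideal.span {((I.pChar : ℕ) : 𝓞 F)}))
    ---- W5b ROW-HOLES (§E′) replacing `hole_dock`∕`hole_hF`∕`hole_hlaw_w`∕`hole_rL` ----
    (hole_fin : HoleFin I quotΩ E' hE' qbarOf) (hole_rkK : HoleRkK I quotΩ E' hE' qbarOf)
    (hole_kill : HoleKill I 𝔡 quotΩ E' hE' qbarOf) (hole_clw : HoleCLW I quotΩ E' hE' qbarOf) :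
    Quot₀RoofLaw I 𝔡 quotΩ (spGeoOf I 𝔡) frobIdeal :=
  roofgeo_of_inputs I 𝔡 quotΩ translΩ _hhecke _hroof _hroof₂ _hunit _hKc _hdisj 𝔞 𝔫 _hdiv _hnorm _hcov _hpin _hspec frobIdeal hfrob
    E' hE' P Q hP hQ hQP hPQ h𝔭 qbarOf hole_mono hole_r1 hole_r4q hole_r5q hole_r3q hole_middle hole_ker
    (holeDock_of_W7 I 𝔡 quotΩ E' hE' qbarOf hole_mono hole_r4q hole_ker hole_fin hole_rkK hole_kill hole_clw)
    (holeHF_of_W7 I 𝔡) hunr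
    (holeHlawW_of_GAP2 I 𝔡 quotΩ E' hE' P qbarOf 𝔞 𝔫 _hnorm _hpin _hspec frobIdeal hole_mono hole_r4q hole_r3q hole_middle hole_ker
      (holeDock_of_W7 I 𝔡 quotΩ E' hE' qbarOf hole_mono hole_r4q hole_ker hole_fin hole_rkK hole_kill hole_clw)
      (holeHF_of_W7 I 𝔡) hunr hole_fin hole_rkK hole_kill hole_clw)
    (holeRL_of_W3 I)

end Head


/-! (★ re-home, size lint: PART 1 of 4 ends here at tree line :339; the workfile continues, in the same namespace, in `Theorems/F0P6aStubFROBRoofGeoWiringAdapters.lean`.) -/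

end Summit.HodgeConjecture.HodgeConjecture.Cruxes.HLiu418.F0P6aStubFROBRoofGeoWiring
end
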